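import Literature.NumberTheory.EllipticCurves.Rank1Residual.Predicates
import HarnessLib

/-!
# Barrier (BirchSwinnertonDyer): no printed anticyclotomic Iwasawa theory at an Eisenstein prime of BAD reduction — every refereed input is printed under `p ∤ N` or under `E[p]` irreducible

Barrier catalogue `Literature/Barriers/BirchSwinnertonDyer/` (D-0021), entry for the technique class
**anticyclotomic Iwasawa theory at an Eisenstein prime: Heegner-point Kolyvagin systems, the
Bertolini–Darmon–Prasanna `p`-adic `L`-function and its value at `𝟙`, the anticyclotomic main
conjectures of Perrin-Riou / Greenberg type, and the two-variable Beilinson–Flach bridge to the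
cyclotomic line** — applied to an elliptic curve `E/ℚ` at a prime `p` with `E[p]` REDUCIBLE and
`p ‖ N` (multiplicative reduction), i.e. the cell's class X2 (`Rank1Residual.ClassX2 W p :=
p ≠ 2 ∧ Red W p ∧ Mult W p`). Suggested by the K5 tribunal judge ("Uncatalogued walls named as crux
text ⇒ suggest Barriers entries `EisensteinMuConjecture`, `ReducibleAnticyclotomicAtBadP`",
`run/shared/lean/pub/ladder-directors/tribunal-bsd/verdict-EisensteinPrimes-bsd-trib-j-1.md` T4),
filed by cell `bsd-eis`, seat `bsd-eis-audit-1` g4 (the sibling entry `EisensteinMuConjecture` is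
seat `bsd-eis-lit`'s). HONEST FRAMING: this is a SCOPE wall — a statement about the PRINTED
standing hypotheses of the refereed literature as of 2026-08-26 — not a no-go theorem about
mathematics; it is struck mechanically by the first refereed theorem proved at `Mult ∧ Red`.

## The wall, as printed (standing hypotheses verbatim; every text held in the literature store)

(A) EVERY refereed anticyclotomic input AT AN EISENSTEIN PRIME is printed for GOOD reduction at `p`:
* Castella–Grossi–Lee–Skinner, Invent. Math. 227 (2022) 517–580 (= arXiv:2008.02571v2, final TeX
  `run/shared/lean/b2b/bsd-rank1-residual/b2b-bsdres-lit-cgls/src/cgls22-v2final/Eisenstein.tex`),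
  §3.2 standing setting L1259–1262: "Let `E/ℚ` be an elliptic curve of conductor `N`, let `p ∤ 2N`
  be a prime of good ordinary reduction for `E`, and let `K` be an imaginary quadratic field of
  discriminant `D_K` prime to `Np`. We assume (h1) `E(K)[p] = 0`." — in force for §§3–4 (Thm. 3.2.1,
  Thm. 4.1.1 Heegner-point Kolyvagin system, Thm. 4.1.2, Prop. 4.2.1, Thm. 4.2.2 = Theorem C);
  tree: `CastellaGrossiLeeSkinner2022.proofThm422_exists_isBDPLFunction_isTorsion_charIdeal_dvd`
  (binder `¬ p ∣ N`), `display54_thm513_generator_constantCoeff` (`Good W p`).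
* Castella–Grossi–Skinner, Math. Ann. 393 (2025) 2451–2506 (= arXiv:2303.04373v2, final TeX
  `run/shared/lean/pub/bsd-eis/audit-1-g4/cgs-arxiv-v2-final.tex`): Theorem A "let `p > 2` be a
  prime of good reduction for `E`" (l.382–392), Theorem C "let `p ∤ 2N` be an Eisenstein prime for
  `E`" (l.506–509), §6 standing "`p ∤ 2N` a prime of good ordinary reduction" (l.2259–2262); the
  proof of its Prop. 3.4.4 (`prop:cong-Sel`; arXiv v1 = store text `paper:arxiv-2303.04373`:
  Prop. 2.4.4) prints the mechanism "for any `w | p` the restriction map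
  `H¹(K_w, M⁻) → H¹(I_w, M⁻)` is an injection (this uses `p ∤ N`)" (final TeX l.1629; the
  parenthetical was ADDED in the accepted version, it is absent from arXiv v1); tree:
  `CastellaGrossiSkinner2025.thmA_charIdeal_eq_padicLFunction` (`Good W p`).
* Castella–Hsieh, Math. Ann. 370 (2018) 567–628 (arXiv:1505.08165, store `paper:arxiv-1505.08165`
  p0003 L4): "Fix an odd prime `p ∤ N`"; Hypothesis (H)(a) "`p ∤ 2(2r−1)!Nφ(N)`" — the BDP
  `p`-adic `L`-function as a measure and its reciprocity law; tree:
  `Literature.NumberTheory.EllipticCurves.castellaHsieh2018_exists_isBDPLFunction` (`¬ p ∣ N`).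
* Bertolini–Darmon–Prasanna, Duke Math. J. 162 (2013), Assumption 5.12 (5): "The rational prime
  `(p) = 𝔭𝔭̄` is split in `K/ℚ` and prime to `Nc`" (store `paper:url-39cfb2a03b1d` p0714–p0718;
  cell dossier `run/shared/lean/pub/bsd-eis/LIT-DOSSIER.md` §2d (b) row 1) — the value formula
  Thm. 5.13 at `𝟙`.
* Burungale–Skinner–Tian–Wan, *Zeta elements for elliptic curves and applications*,
  arXiv:2409.01350v2 (PREPRINT; the two-variable Beilinson–Flach element behind CGS 2025 Thm. 4.1.1),
  §2.2 (TeX `run/shared/lean/pub/bsd-eis/audit-1-g4/bstw-arxiv-2409.01350v2.tex` l.1136–1141):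
  "To simplify some arguments, we will always assume that `p ∤ N`"; and Kings–Loeffler–Zerbes,
  Camb. J. Math. 5 (2017), Thm. 7.7.2 interpolates "if `f, g` are `p`-stabilisations of eigenforms
  `f₀, g₀` of levels `N_f, N_g` [prime to `p`]" (store `paper:arxiv-1503.02888-gx17373040` p0066) —
  dossier §2b bottom line: "nothing in print evaluates the BF class / `L_p(𝐚,𝐠)` at a `p`-new
  weight-2 point".
* Keller–Yin, arXiv:2402.12781v2 (PREPRINT), Theorem A = Thm. 3.0.8: "`p > 2` an ordinary
  Eisenstein prime not dividing `N`" (tree `KellerYin2024` facts, `Good W p`); the same preprint's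
  Theorem D = Thm. 5.1.3 is the one CLAIMED result inside the wall — see evasions_known (i).

(B) EVERY refereed anticyclotomic / `p`-part input AT A MULTIPLICATIVE PRIME is printed for
IRREDUCIBLE `E[p]`:
* Castella, Camb. J. Math. 6 (2018) 1–23 (arXiv:1704.06608, store `paper:arxiv-1704.06608` p0005
  L5): "Let `E/ℚ` be a semistable elliptic curve of conductor `N`, and let `p ≥ 5` be a prime such
  that `ρ̄_{E,p}` … is irreducible" — Thm. 2.3 (anticyclotomic control at `p ∣ N`), Thm. 3.2, Thm. A;
  tree `Castella2018.thm23_anticyclotomicControl` (`Irr W p`), and its author's ERRATUM (2024,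
  unrefereed; `Castella2018Erratum`) Thm. A′ / Thm. 1.1: "multiplicative reduction at `p > 3`, `E[p]`
  irreducible, …" — tree `Castella2018.erratumThm11_exists_isBDPLFunction_isTorsion_charIdeal_eq_OPEN`
  (`Mult W p`, `Irr W p`).
* Skinner, Pacific J. Math. 283 (2016) 171–200, Thms. A–C (cyclotomic main conjecture and rank-`0`
  `p`-part at `p ‖ N`): `E[p]` irreducible + (ram) — tree `Skinner2016.thmA_charIdeal_multiplicative`
  (`W.HasIrreducibleModPGaloisRep p`).
* Skinner–Zhang, *Indivisibility of Heegner points in the multiplicative case*, arXiv:1407.1099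
  (2014): `ρ̄` irreducible (surjective-type image hypotheses) — `SkinnerZhang2014`.
* Disegni, Kyoto J. Math. (2020) (`p`-adic BSD in rank `≤ 1`, multiplicative clauses): tree
  `Disegni2020.padicBSD_rankOne_splitMult_of_irreducible` (irreducible added explicitly, its
  docstring: "`A_p` irreducible … inherited and made EXPLICIT").
* Castella, JIMJ 17 (2018) 207–240 (arXiv:1507.04260; split multiplicative big Heegner points,
  `p ≥ 5`, store p0003 L3–L14) — value formulas Thms. 2.10/2.11 at a `p`-new form, no Eisenstein
  statement; Greenberg–Vatsal 2000 / Greenberg LNM 1716 §§2–4 treat the CYCLOTOMIC line at `p ‖ N`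
  (the cell's flag audit `AUDIT-1-GV00-MULT-D-AUDIT.md`), not the anticyclotomic one.

(C) So at `(E, p)` with `p ‖ N` AND `E[p]` reducible — class X2, the K5 route's rows A10 / B11
(cell `bsd-eis`, `run/shared/lean/pub/bsd-eis/TARGET.md` §7; crux 4 `BSDpOnCellC` why_might_fail:
"R₀-descent of Hsieh's witness at a reducible `p ‖ N` — in print only for `p ∤ N` (CH18 Def 3.5) /
`p ≥ 5` irreducible (Cas18 Thm 3.1)") — NO refereed input of the technique class applies as
printed. The two printed sides of the wall are recorded in the Lean predicate
`PrintedEisensteinAnticyclotomicScope W p := Good W p ∨ Irr W p`; the barrier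
`ReducibleAnticyclotomicAtBadP` ("class X2 meets no printed scope") is then a THEOREM
(`reducibleAnticyclotomicAtBadP_holds`): good and multiplicative reduction exclude each other
(Mathlib `WeierstrassCurve.HasMultiplicativeReduction.not_hasGoodReduction`, Silverman AEC VII.5.1)
and `Red = ¬ Irr` by definition. Companion: `not_anom_of_mult` — the cell's predicate `Anom`
(CGS's excluded configuration "`φ|_{G_p} ∈ {𝟙, ω}`", DEFINED with good reduction) is vacuous at a
multiplicative prime, so no `¬ Anom`-hypothesis fact of the tree separates the split from the
non-split X2 sub-row; at X2 that separation is the sign `a_p = ±1` (Tate's `p`-adic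
uniformisation: `E[p]|_{G_p}` is an extension of `𝔽_p(δ)` by `𝔽_p(δω)` with `δ` unramified
quadratic, trivial iff split — so the rational line's character restricted to `G_p` lies in
`{δ, δω}`: the CGS-admissible shape "`≠ 𝟙, ω`" iff non-split; this Galois-theoretic refinement is
not proved IN THIS FILE — a `Literature` module cannot import `Summits.*` — but it IS a theorem of
the tree on the Summits side, unconditional since the Tate-uniformisation facts A40/A41 it consumes
are discharged in `Literature/NumberTheory/EllipticCurves/TateCurve/`: the decomposition-group
form `Summit.BirchSwinnertonDyer.Rank1Residual.X2.TateLineDecomposition.not_fix_and_not_quot_of_not_split`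
/ `.fix_or_quot_of_split`, its dictionary to the cell's predicates
`Summit.BirchSwinnertonDyer.Rank1Residual.X2.CongruentPartnerAnomalous.not_dvd_frobeniusTrace_sub_one_of_torsionIso_of_not_split`
/ `.dvd_frobeniusTrace_sub_one_of_torsionIso_of_split` / `.split_iff_split_of_torsionIso`, and the
Tate-free inertia line `Summit.BirchSwinnertonDyer.Rank1Residual.KernelDisc.exists_inertiaLine_of_mult`
— exact statements and locators in scope_caveats (c); D-0021 accuracy audit of this entry by the
filing seat's successor g5, 2026-08-26). Keller–Yin print the residual programme themselves
(arXiv:2402.12781v2, Remark after Theorem D, L311): "our Main Conjecture would yield both rank `0`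
and rank `1` BSD formulae at multiplicative primes provided the results in [CGS] are extended to
higher weight modular forms", and §0.6 (L353): "This is what we will examine in later work" —
unwritten as of 2026-08-26 (cell dossier §1).

## D-0021 structured block
The six key lines `technique_class` / `blocks` / `because` / `evasions_known` / `scope_caveats` /
`status` of this entry are carried by the docstring of the declaration
`ReducibleAnticyclotomicAtBadP` below: the gate's barrier catalogue parses DECLARATION docstrings
(`docs/reference/gate.md`, row `stats.barriers`), and a planner's `route edit` naming
`Literature.Barriers.BirchSwinnertonDyer.ReducibleAnticyclotomicAtBadP` bounced «unknown barrier
decl» while the lines sat in this module docstring (cell `bsd-eis`, 2026-08-26); they were moved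
there VERBATIM by the filing seat's successor g9 — no Lean statement of this file changed.

## References (bib keys of `lean/references.bib`)
[CastellaGrossiLeeSkinner2022] §3.2, Thms. 3.2.1, 4.1.1, 4.1.2, Prop. 4.2.1, Thm. 4.2.2 ·
[CastellaGrossiSkinner2025] Thms. A, C, §6, Thm. 4.1.1, final TeX l.1622 · [CastellaHsieh2018] §1,
(H) · [BertoliniDarmonPrasanna2013] Ass. 5.12, Thm. 5.13 · [KingsLoefflerZerbes2017] Thm. 7.7.2 ·
[BurungaleSkinnerTianWan2024] §2.2 · [KellerYin2024] Thm. 3.0.8, §5 · [Castella2018] §2.1, Thms.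
2.3, 3.2, A · [Castella2018Erratum] Thm. A′ · [Skinner2016PacificMC] Thms. A–C · [SkinnerZhang2014]
· [Disegni2020] · [Castella2018Exceptional] Thms. 2.10–2.11 · [Hsieh2014] Thm. 1 ·
[LiuZhangZhang2018] Thm. 3.10 · [KrizLi2019] · [GreenbergVatsal2000] · [GreenbergLNM1716] §§2–4 ·
[Castella2024] · [SilvermanATAEC1994] Ch. V Lemma 5.2 (c), Thm. 5.3, Cor. 5.4 (Tate
uniformisation, scope_caveats (c)) · [SerreInventiones1972] §1.11 Prop. 11–12, §1.12 Cor. of Prop. 13.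
Cell documents: `run/shared/lean/pub/bsd-eis/LIT-DOSSIER.md` §§2b, 2c, 2d, 25,
31, 32; `TARGET.md` §1.3, §7; `AUDIT-1-GV00-MULT-D-AUDIT-ADDENDUM-2.md` (BSTW §5 read). Tree files
named in scope_caveats (c) (Summits side, not importable here):
`Summits/BirchSwinnertonDyer/Rank1Residual/X2/TateLineDecomposition.lean`,
`…/X2/CongruentPartnerAnomalous.lean`, `…/X2/GreenbergVatsalTateFrobeniusSign.lean`,
`…/Partition/EisensteinKernelInertiaLineMult.lean`, `…/Partition/EisensteinKernelTypeMultiplicative.lean`;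
Literature side: `Literature/NumberTheory/EllipticCurves/TateCurve/NumberFieldUniformization.lean`,
`…/TateCurve/NumberFieldUniformizationTwisted.lean`, `…/TateUniformisation.lean` (A40/A41),
`…/SemistableModPImageMultiplicativeProofs.lean`, `…/Rank1Residual/AnomalousDictionaryPrimesAboveProofs.lean`.
-/

open WeierstrassCurve Literature.NumberTheory.EllipticCurves.Rank1Residual

namespace Literature.Barriers.BirchSwinnertonDyer

/-- The technique class of this entry, as a predicate on `(E, p)`: the PRINTED standing hypotheses
under which a refereed anticyclotomic IMC / Heegner-point Kolyvagin system / BDP value formula /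
Beilinson–Flach reciprocity law at an Eisenstein or multiplicative prime is stated —
GOOD reduction at `p` (list (A) of the module docstring: CGLS 2022 §3.2, CGS 2025 §6 and Thms.
A/C, Castella–Hsieh 2018, BDP 2013 Ass. 5.12 (5), BSTW §2.2, KLZ17 Thm. 7.7.2) OR irreducible
`E[p]` (list (B): Castella 2018 §2.1 and Erratum Thm. A′, Skinner 2016 Thms. A–C, Skinner–Zhang
2014, Disegni 2020). [cite: CastellaGrossiLeeSkinner2022, §3.2 standing setting]
[cite: Castella2018, §2.1 standing hypotheses] -/
def PrintedEisensteinAnticyclotomicScope (W : WeierstrassCurve ℚ) (p : ℕ) [Fact p.Prime] : Prop :=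
  Good W p ∨ Irr W p

/-- **The barrier** (scope wall; the located literature lists (A)/(B)/(C) are in the module
docstring): at a pair `(E, p)` with multiplicative reduction at `p` and `E[p]` reducible — the
cell's class X2 — the pair lies in NONE of the printed scopes of the technique class: neither the
good-reduction scope of the Eisenstein-prime anticyclotomic theorems nor the irreducible scope of
the multiplicative-prime theorems. PROVED below (`reducibleAnticyclotomicAtBadP_holds`); the closed
`Prop` is the decl that idea cards and route theses cite.

BARRIER (D-0021), one line per key:
* technique_class: anticyclotomic-iwasawa-theory heegner-point-kolyvagin-systems bdp-padic-L-function beilinson-flach-classes eisenstein-congruences — formally `PrintedEisensteinAnticyclotomicScope W p` (the disjunction of the printed standing hypotheses (A) `Good W p` / (B) `Irr W p`) evaluated on the class `Mult W p ∧ Red W p` (`Rank1Residual.ClassX2`)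
* blocks: at every `(E, p)` of class X2 (`p` odd, `E[p]` reducible, `p ‖ N`; cell rows A10 and B11 — row B11 alone is 12 665 (class, p) cells of the cell's census, `run/shared/lean/pub/bsd-eis/TARGET.md` §7), every DIRECT citation of a refereed anticyclotomic main conjecture / BDP value formula / Heegner-point Kolyvagin-system theorem / Beilinson–Flach reciprocity law to the pair itself: the K5 route `route-BirchSwinnertonDyer-EisensteinPrimes` cruxes `BSDpOnCellC` (stmt-BirchSwinnertonDyer-19034; atoms c1 `HsiehFrameResidualAt`, c2 value, c3 IMC, CTL) and the non-split sub-row of `MazurMCOnCellB` (stmt-BirchSwinnertonDyer-19033, "CGS §§1–3, 6 at the p-new point = R9-WORK") can import NO tree fact of the families `CastellaGrossiLeeSkinner2022.*`, `CastellaGrossiSkinner2025.*`, `CastellaHsieh2018.*`, `Castella2018.*`, `Skinner2016.*`, `Disegni2020.*` at the X2 pair [cite: CastellaGrossiLeeSkinner2022, §3.2 (standing setting, p ∤ 2N good ordinary)] [cite: CastellaGrossiSkinner2025, Theorem A and §6 standing hypotheses (p ∤ 2N)] [cite: Castella2018, §2.1 (p ≥ 5, ρ̄_{E,p} irreducible)]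 [cite: Skinner2016PacificMC, Thm. A (E[p] irreducible)]
* because: (A) the Eisenstein-prime anticyclotomic theorems are all proved for `p ∤ N`: the Heegner-point Kolyvagin system and its control are set up for `T_pE ⊗ Λ` with the ORDINARY local condition at the good prime `p` [cite: CastellaGrossiLeeSkinner2022, §3.2 L1259–1262, Thm. 3.2.1, Thm. 4.1.1, Prop. 4.2.1]; CGS 2025's congruence argument uses `p ∤ N` explicitly ("this uses `p ∤ N`", proof of Prop. 3.4.4, final TeX l.1629) and its Beilinson–Flach input is printed at `p`-stabilised points of level prime to `p` only [cite: CastellaGrossiSkinner2025, Prop. 3.4.4 (proof) and Thm. 4.1.1 (arXiv v1: Prop. 2.4.4, Thm. 3.1.1)] [cite: KingsLoefflerZerbes2017, Thm. 7.7.2 (interpolation at p-stabilisations of level prime to p)] [cite: BurungaleSkinnerTianWan2024, §2.2 ("we will always assume p ∤ N")]; the BDP function and its value at 𝟙 are printed for `p` prime to `N` [cite: BertoliniDarmonPrasanna2013, Assumption 5.12 (5) and Thm. 5.13] [cite: CastellaHsieh2018, §1 ("odd prime p ∤ N") and Hypothesis (H)(a)]; (B) the multiplicative-prime theorems all invoke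 an irreducible (or surjective) residual image — for the Skinner–Urban / Kato / W. Zhang inputs and for the indivisibility of Heegner points [cite: Castella2018, §2.1 and Thm. A] [cite: Castella2018Erratum, Thm. A′ / Thm. 1.1 (E[p] irreducible)] [cite: Skinner2016PacificMC, Thms. A–C] [cite: SkinnerZhang2014, Thm. 1.1 (image hypotheses)] [cite: Disegni2020, Thm. 4 as transcribed (irreducible)]; hence the printed scopes are `Good W p` or `Irr W p`, and `Mult W p` excludes the first (Silverman AEC VII.5.1; Mathlib `HasMultiplicativeReduction.not_hasGoodReduction`) while `Red W p` is the negation of the second — which is all the Lean proof uses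
* evasions_known: (i) CHANGE THE POINT: pass through a Hida family to the `p`-new weight-2 point and descend — printed (refereed) for the CYCLOTOMIC main conjecture at `p ‖ N` with `E[p]` IRREDUCIBLE [cite: Skinner2016PacificMC, Thm. A and §3]; for the reducible anticyclotomic main conjecture CLAIMED in a preprint: Keller–Yin arXiv:2402.12781v2 Theorem D = Thm. 5.1.3 ("Let `f` be a newform of weight `2` and `p ‖ N` an odd Eisenstein prime of multiplicative reduction … `Char(𝔛_f)Λ^{nr} = (𝓛_f)`"; the "Hida limit", road H of the cell, `Summits/BirchSwinnertonDyer/Rank1Residual/X2/HidaLimitRoad.lean`, with the cell-audited inputs [Skinner 2016 §3.1], [Castella 2020 JIMJ Thm. 2.11], [Castella arXiv:2409.01360, preprint], [BCK21 Thm. 5.1] and the unprinted lattice-congruence input (α) at a residually reducible family — `KellerYin2024` is unrefereed as of 2026-08-26, so it does not strike this entry yet; its companion preprint arXiv:2410.23241, p. 4: "In the multiplicative reduction case, one proves the Greenberg's Main Conjecture using congruence in a Hida family") [cite: KellerYin2024, Theorem D = Thm. 5.1.3 and Remark following it (preprint)] [cite: KellerYin2024PotOrd, §0.4–0.5 (preprint)];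 (ii) CHANGE THE CURVE: congruence transfer of `μ = 0` / `λ` to a good-ordinary `p`-congruent relative and back (Greenberg–Vatsal route G; the cell's kernel theorems `X2.mazurMainConjectureAt_of_lamMin`, `…_of_coveredRelative_of_not_split`, 51 A10 cells closed this way) — evades the wall for the CYCLOTOMIC main conjecture on row A10, not for the anticyclotomic atoms of row B11 [cite: GreenbergVatsal2000, Thm. (1.3) and §3]; (iii) PIECES IN PRINT at `p ∣ N` without a reducibility restriction: the `Λ`-adic anticyclotomic `p`-adic `L`-function as an integral measure with interpolation, `π_p` special allowed [cite: Hsieh2014, Thm. 1 (= Thm. 5.6)], the `p`-adic Waldspurger identity at `χ = 𝟙` for any `π_p` as an identity in a line [cite: LiuZhangZhang2018, Thm. 3.10], the value formulas at a `p`-new form (printed under "split multiplicative, `p ≥ 5`", used symbolically in `a_p`) [cite: Castella2018Exceptional, Thms. 2.10–2.11] — their assembly into a value-at-𝟙 theorem in one normalisation at a reducible `p ‖ N` is nowhere printed (cell dossier §2d (b) VERDICT; x11b3 LIT-TABLE-K §13(IV)); (iv) Greenberg–Vatsal / Greenberg LNM 1716 §§2–4 handle `p ‖ N` on the CYCLOTOMIC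 line only [cite: GreenbergLNM1716, §§2–4 (p ∥ N)]
* scope_caveats: (a) this is a SCOPE wall about refereed print as of 2026-08-26, not a theorem about Selmer groups: the first refereed proof of an anticyclotomic main conjecture / BDP value formula / reciprocity law at a pair with `Mult W p ∧ Red W p` strikes it (mechanically: the disjunction `PrintedEisensteinAnticyclotomicScope` then acquires a third printed disjunct met by X2); (b) the Lean theorem proves only the incompatibility of the PRINTED standing hypotheses (good reduction, irreducibility) with class X2 — the content of the entry is the located list (A)/(B), whose completeness is a literature claim (cell dossier `LIT-DOSSIER.md` §§2b–2d, 18, 25, 31–32; `presearch` lines in the filing seat's NOTES) and can be refuted by exhibiting ONE refereed theorem of the technique class stated at `p ∣ N` with `E[p]` reducible; (c) the Galois-theoretic mechanism at X2 — Tate's `E[p]|_{G_{ℚ_p}} ≅ (𝔽_p(δω) ↪ E[p] ↠ 𝔽_p(δ))`, `δ` unramified quadratic, trivial iff split, so that the isogeny character restricted to `G_p` lies in `{δ, δω}` and the CGS/GV "non-anomalous" shape `φ|_{G_p} ∉ {𝟙, ω}` holds EXACTLY on the non-split sub-row (Tate's `p`-adic uniformisation; the ordinary filtration at `p ‖ N`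 as used on the cyclotomic line by Greenberg–Vatsal 2000 and Greenberg LNM 1716 §§2–4) — is NOT proved in THIS file: a `Literature` module cannot import `Summits.*`, so here only its shadow on the cell's predicates is (`Mult → ¬ Anom`, because `Anom` is DEFINED with good reduction), next to Serre's Literature-side local shape `WeierstrassCurve.exists_addSubgroup_card_le_of_hasMultiplicativeReductionAt` (at a multiplicative `v ∣ p`, `p` odd: a subgroup `X ≤ E[p]` with `#X ≤ p` and `τ • P − P ∈ X` for every `P ∈ E[p]` and every `τ` of the inertia group of a prime above `v`) [cite: SerreInventiones1972, §1.12, Cor. of Prop. 13]; but the mechanism IS PROVED IN THE TREE on the Summits side (cell `b2b-bsdres`, units `eisenstein-p2` / `lit-cgls`; D-0021 accuracy audit of this entry, 2026-08-26), for a globally minimal `W/ℚ`, `p` odd, `v` the place of `ℚ` at `p` and `D_v ≤ Γ_ℚ` the decomposition group of the tree's prime above `v` (`decomp v`): NON-SPLIT `p ‖ N` ⇒ for EVERY subgroup `Φ ≤ E[p]` of order `p`, `D_v` neither fixes `Φ` pointwise nor acts trivially on `E[p]/Φ` ("`φ|_{G_p} ≠ 𝟙, ω`"; an arithmetic Frobenius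 flips `√γ`, `γ = −c₄/c₆`, `Summit.BirchSwinnertonDyer.Rank1Residual.X2.GreenbergVatsalTateFrobeniusSign.frob_smul_sqrt_gamma_eq_neg`) — `Summit.BirchSwinnertonDyer.Rank1Residual.X2.TateLineDecomposition.not_fix_and_not_quot_of_not_split` (`Summits/BirchSwinnertonDyer/Rank1Residual/X2/TateLineDecomposition.lean`); SPLIT `p ‖ N` ⇒ for every `D_v`-stable subgroup `Φ ≤ E[p]` of order `p`, `D_v` fixes `Φ` pointwise or acts trivially on `E[p]/Φ` ("`φ|_{G_p} ∈ {𝟙, ω}`") — `…X2.TateLineDecomposition.fix_or_quot_of_split`; both take the PUBLISHED Tate uniformisation as a binder `hT` — the named facts A41 `Literature.NumberTheory.EllipticCurves.Silverman1994_thmV53_corV54_tateUniformisation` (twisted form, any multiplicative `v`) resp. A40 `Literature.NumberTheory.EllipticCurves.Silverman1994_thmV53_tateUniformisation` (split `v`) — and BOTH binders are DISCHARGED in the tree, `Literature.NumberTheory.EllipticCurves.TateCurve.Silverman1994_thmV53_corV54_tateUniformisation_holds` (`Literature/NumberTheory/EllipticCurves/TateCurve/NumberFieldUniformizationTwisted.lean`)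 and `Literature.NumberTheory.EllipticCurves.TateCurve.Silverman1994_thmV53_tateUniformisation_holds` (`…/TateCurve/NumberFieldUniformization.lean`), so the statements hold unconditionally [cite: SilvermanATAEC1994, Ch. V Lemma 5.2 (c), Thm. 5.3, Cor. 5.4] [cite: GreenbergVatsal2000, §2 pp. 14–15 (C ≅ μ_{p^∞}(δ), A/C ≅ ℚ_p/ℤ_p(δ))]; their dictionary to the cell's predicates along a mod-`p` congruence `TorsionIso W W' p` with a relative `W'` of GOOD reduction at `p` (Serre 1972 §1.11: at a good prime `p > 2` with a rational `p`-line `Φ`, `Anom W p` ⇔ the decomposition group fixes `Φ` pointwise or acts trivially on `E[p]/Φ` — tree `Literature.NumberTheory.EllipticCurves.Rank1Residual.anom_iff_decomposition_of_mem_primesAbove`): non-split X2 pair ⇒ `p ∤ a_p(W') − 1`, the good relative is NON-anomalous and indeed a covered pair of Castella–Grossi–Skinner 2025 Thm. A — `Summit.BirchSwinnertonDyer.Rank1Residual.X2.CongruentPartnerAnomalous.not_dvd_frobeniusTrace_sub_one_of_torsionIso_of_not_split`, `…covered_partner_of_torsionIso_of_not_split`; split X2 pair ⇒ `p ∣ a_p(W')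 − 1`, every good relative is ANOMALOUS — `…dvd_frobeniusTrace_sub_one_of_torsionIso_of_split`; two multiplicative members of a congruence are split or non-split together — `…split_iff_split_of_torsionIso` (`…/X2/CongruentPartnerAnomalous.lean`) [cite: SerreInventiones1972, §1.11 (1), Prop. 11–12]; and the INERTIA-level statement (the Tate line `μ_p`: at every prime `𝔓` of `\bar ℤ` above `p` a line `L ≤ E[p]` of order `p` with `σ • P − P ∈ L` for all `σ ∈ I_𝔓`, `P ∈ E[p]`, and a point of `L` moved by `I_𝔓` — inertia acts through `(ω *; 0 1)`) is proved WITHOUT any Tate-uniformisation input — `Summit.BirchSwinnertonDyer.Rank1Residual.KernelDisc.exists_inertiaLine_of_mult` (`…/Partition/EisensteinKernelInertiaLineMult.lean`) — together with its Greenberg–Vatsal-type consequences `…KernelDisc.gvType_iff_of_isRationalLine_of_hasMultiplicativeReduction` (at an odd multiplicative `p` the GV type "(ramified ∧ even) ∨ (unramified ∧ odd)" of a rational `p`-line does not depend on the line) and `…KernelDisc.gvPar_iff_of_isIsogenous_of_hasMultiplicativeReduction` (`GVPar W p` is a `ℚ`-isogeny-class invariant) (`…/Partition/EisensteinKernelTypeMultiplicative.lean`)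 [cite: SerreInventiones1972, §1.12, Cor. of Prop. 13] [cite: GreenbergVatsal2000, Thm. (1.3) and §2 p. 28]; so what this caveat records is an IMPORT restriction of the Literature layer, not a gap of the tree; (d) additive reduction (`p² ∣ N`, class X3) is outside this entry (the cell's `AdditiveBranch` route and `Barriers` are separate); (e) `p = 2` is outside class X2 by definition
* status: established (theorem `reducibleAnticyclotomicAtBadP_holds`; the literature list (A)/(B) read at the page by seats bsd-eis-lit (dossier §§2b–2d) and bsd-eis-audit-1 (this file), 2026-08-26; scope_caveats (c) and paragraph (C) corrected the same day by the filing seat's successor (D-0021 accuracy audit): the X2 Galois mechanism is a theorem of the tree on the Summits side, named there — no Lean statement of this file changed)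

[cite: CastellaGrossiLeeSkinner2022, §3.2] [cite: CastellaGrossiSkinner2025, Theorem A and §6]
[cite: Castella2018, §2.1] [cite: Skinner2016PacificMC, Thm. A] -/
def ReducibleAnticyclotomicAtBadP : Prop :=
  ∀ (W : WeierstrassCurve ℚ) (p : ℕ) [Fact p.Prime],
    Mult W p → Red W p → ¬ PrintedEisensteinAnticyclotomicScope W p

/-- Multiplicative reduction at `p` excludes good reduction at `p` for the cell's prime-indexed
predicates (both are read on the `ℤ_p`-minimal model of `W/ℚ_p`; Mathlib
`WeierstrassCurve.HasMultiplicativeReduction.not_hasGoodReduction`).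
[cite: SilvermanAEC2009, Prop. VII.5.1 (good / multiplicative / additive trichotomy)] -/
theorem not_good_of_mult (W : WeierstrassCurve ℚ) (p : ℕ) [Fact p.Prime] (h : Mult W p) :
    ¬ Good W p := by
  intro hg
  have h' : ((W.baseChange ℚ_[p]).minimal ℤ_[p]).HasMultiplicativeReduction ℤ_[p] := h
  have hg' : ((W.baseChange ℚ_[p]).minimal ℤ_[p]).HasGoodReduction ℤ_[p] := hg
  exact h'.not_hasGoodReduction _ hg'

/-- The barrier holds: `Mult` excludes the good-reduction scope and `Red = ¬ Irr` excludes the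
irreducible scope. [cite: CastellaGrossiLeeSkinner2022, §3.2] [cite: Castella2018, §2.1] -/
theorem reducibleAnticyclotomicAtBadP_holds : ReducibleAnticyclotomicAtBadP := by
  intro W p _ hmult hred hscope
  rcases hscope with hgood | hirr
  · exact not_good_of_mult W p hmult hgood
  · exact hred hirr

/-- Class-X2 form of the barrier: the cell's class `ClassX2 W p` (`p ≠ 2 ∧ Red W p ∧ Mult W p`,
rows A10/B11) meets no printed scope of the technique class. [cite: CastellaGrossiLeeSkinner2022, §3.2]
[cite: Castella2018, §2.1] -/
theorem classX2_not_printedScope (W : WeierstrassCurve ℚ) (p : ℕ) [Fact p.Prime]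
    (hX : ClassX2 W p) : ¬ PrintedEisensteinAnticyclotomicScope W p :=
  reducibleAnticyclotomicAtBadP_holds W p hX.2.2 hX.2.1

/-- Companion: the cell's predicate `Anom W p` ("anomalous Eisenstein prime of GOOD reduction",
the configuration `φ|_{G_p} ∈ {𝟙, ω}` excluded by Castella–Grossi–Skinner 2025, Theorem A) is
vacuous at a multiplicative prime — it is DEFINED with good reduction — so every tree fact carrying
`Good W p`, `¬ Anom W p` or `Anom W p` is silent on class X2, split and non-split alike.
[cite: CastellaGrossiSkinner2025, Theorem A (standing hypothesis "p > 2 a prime of good reduction", excluded case φ|G_p = 1, ω)]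
[cite: SilvermanAEC2009, Prop. VII.5.1] -/
theorem not_anom_of_mult (W : WeierstrassCurve ℚ) (p : ℕ) [Fact p.Prime] [W.IsGloballyMinimal]
    (h : Mult W p) : ¬ Anom W p :=
  fun ha => not_good_of_mult W p h ha.2.1

end Literature.Barriers.BirchSwinnertonDyer
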